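import Mathlib
import HarnessLib
import Summits.Ventures.LatticeQCDFlow.Scoring.BlockStatisticsCeilingFree
import Summits.Ventures.LatticeQCDFlow.Scoring.AcceptanceMonitorConcentration

/-!
# The PRINTED acceptance ratio WITHOUT a weight ceiling: the median over `R` blocks of the
# scale-free all-pairs ratio `(Σ_{i≠j} min(w̃ᵢ, w̃ⱼ)/(m(m−1))) / (Σ_j w̃ⱼ/m)` certifies `acc(p, q)`
# at confidence `1 − e^{−R/8}` from `∫ p²/q < ∞` (a positive ESS) alone

HONEST FRAMING: exact (Metropolis-corrected) sampling algorithms for lattice gauge theory;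
figures of merit are autocorrelation/cost numbers at stated couplings and volumes; no
continuum-physics claim.

Venture `LatticeQCDFlow` (cell pub-lqcd), topic `Scoring`; FANOUT row 4 (`s0-u1-b`, rung S0-B: two
independent codes A, B for the 2D U(1) flow sampler; acceptance test "A vs B within 3 pp").
Sequel of row 4's `Scoring/AllPairsAcceptanceCeilingFree` (the median of the block all-pairs
estimates `Û_r` with NORMALISED weights `w = p/q`, ceiling-free, `e^{−R/8}`) in the direction of
row 4's `Scoring/AllPairsAcceptanceRatio` (the PRINTED ratio with UNNORMALISED weights
`w̃ = c·w`, `c = Z` unknown — there certified only under a ceiling `p ≤ Wq`).  A code holds `w̃`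
on its `n` proposals; on block `r` (draws `rm, …, rm + m − 1`) it prints the scale-free ratio

  `R_r = ( Σ_{i≠j<m} min(w̃_{rm+i}, w̃_{rm+j}) / (m(m−1)) ) / ( Σ_{j<m} w̃_{rm+j} / m ) = Û_r / W̄_r`.

Per block, CHEBYSHEV twice (`Scoring/BlockStatisticsCeilingFree`, imported):
`P(t ≤ |Û_r − acc|) ≤ E_m(acc)/t²` with row 3's ceiling-free envelope
`E_m(a) = (2(1 − a²) + 4(m − 2)(a − a²))/(m(m − 1)) ≤ 1/(m − 1)`, and
`P(u ≤ |W̄_r − 1|) ≤ (M₂ − 1)/(m u²)` with `M₂ = ∫ p²/q dμ = 1/ESS`; then the tree's deterministic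
ratio step `Scoring.abs_div_sub_lt_of_abs_sub_lt` (`|Û − a| < t`, `|W̄ − 1| < u < 1`,
`0 ≤ a ≤ 1` ⇒ `|Û/W̄ − a| < (t + u)/(1 − u)`), so block `r` is bad with probability `≤ 1/8 + 1/8`
once `8E_m(acc) ≤ t²` and `8(M₂ − 1) ≤ m u²`; the block ratios are independent, and row 4's
finite-index median device `BlockMedian.measureReal_half_far_le` concludes.  The ONLY analytic
input is `p²/q ∈ L¹(μ)` (a positive effective sample size); no ceiling, no parity hypothesis, no
variance estimate.

## Content (`M₂ = ∫ p²/q dμ`; `acc = ∫∫ min(p(a)q(b), p(b)q(a)) dμ dμ`)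

* **`printedAcceptance_medianOfBlocks_confidence`** — `m ≥ 2`, `R·m ≤ n`, `t > 0`, `0 < u < 1`,
  `8E_m(acc) ≤ t²`, `8(M₂ − 1) ≤ m u²`, any normalisation `c > 0`:
  `P( #{r < R : (t+u)/(1−u) ≤ |R_r − acc|} ≥ R/2 ) ≤ exp(−R/8)`;
* **`printedAcceptance_sampleMedian_confidence`** — for ANY sample-median selection `med(ω)` of
  the printed `R_0, …, R_{R−1}` and the a-priori radii `8/(m − 1) ≤ t²`, `8(M₂ − 1) ≤ m u²`:
  `P( (t+u)/(1−u) ≤ |med − acc| ) ≤ exp(−R/8)`;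
  `printedAcceptance_AB_sampleMedian_confidence` — two codes, own streams and normalisations,
  no parity hypothesis: the two bad events together have probability `≤ e^{−R/8} + e^{−R′/8}`.

Reading for row 4 (value-free; no number of ours, no sealed value): the acceptance a code prints
per block from its own unnormalised weights is certified to `±(t+u)/(1−u)`, `t ≈ √(8/m)`,
`u ≈ √(8(1/ESS − 1)/m)`, at confidence `1 − e^{−R/8}` — the effective sample size being the only
input where `Scoring/AllPairsAcceptanceRatio` needed the ceiling `W`.  NEW WORK of the cell
(elementary); no definition is introduced; nothing is cited as a fact.  NOT CLAIMED: estimating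
`M₂` (an input; any upper bound works); a data-driven block count; any number of ours re-scored.
-/

noncomputable section

namespace Summit.Ventures.LatticeQCDFlow.Scoring.AllPairsMedian

open MeasureTheory ProbabilityTheory Finset Real Set
open Summit.Ventures.LatticeQCDFlow.Scoring.BlockMedian

/-! ## §2 The ceiling-free certificates for the PRINTED ratio -/

section Certificate

variable {Ω : Type*} [MeasurableSpace Ω] {P : Measure Ω} [IsProbabilityMeasure P]
variable {X : Type*} [MeasurableSpace X] {μ : Measure X} [SFinite μ]
variable {n m R : ℕ}

set_option maxHeartbeats 400000 in
/-- **THE PRINTED RATIO, CEILING-FREE, EXPONENTIAL CONFIDENCE (oracle envelope).**  `n` independent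
model draws `y_j` (laws `μ.withDensity q`), target `p ≥ 0` with `∫ p = 1`, model `q > 0`,
`p²/q ∈ L¹(μ)` (a positive ESS; `M₂ = ∫ p²/q dμ`), NO ceiling; weights printed with ANY
normalisation `w̃ = c·p/q`, `c > 0`; blocks of `m ≥ 2` draws, `R·m ≤ n`; `t > 0`, `0 < u < 1` with
`8·E_m(acc) ≤ t²` and `8(M₂ − 1) ≤ m u²`.  With `R_r` the printed ratio of block `r`:
`P( #{r < R : (t+u)/(1−u) ≤ |R_r − acc(p,q)|} ≥ R/2 ) ≤ exp(−R/8)`. [ours] -/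
theorem printedAcceptance_medianOfBlocks_confidence {y : Fin n → Ω → X}
    (hym : ∀ j, Measurable (y j)) (hind : iIndepFun y P) {p q : X → ℝ} (hp0 : ∀ z, 0 ≤ p z)
    (hpm : Measurable p) (hpi : Integrable p μ) (hp1 : ∫ z, p z ∂μ = 1) (hq0 : ∀ z, 0 < q z)
    (hqm : Measurable q) (hqi : Integrable q μ) (hM2i : Integrable (fun z => p z ^ 2 / q z) μ)
    (hlaw : ∀ j, Measure.map (y j) P = μ.withDensity fun z => ENNReal.ofReal (q z))
    {wt : X → ℝ} {c : ℝ} (hc : 0 < c) (hwt : ∀ z, wt z = c * (p z / q z))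
    (hm : 2 ≤ m) (hRm : R * m ≤ n) {t u : ℝ} (ht : 0 < t) (hu : 0 < u) (hu1 : u < 1)
    (hvt : 8 * ((2 * (1 - (∫ a, ∫ b, min (p a * q b) (p b * q a) ∂μ ∂μ) ^ 2)
        + 4 * (m - 2) * ((∫ a, ∫ b, min (p a * q b) (p b * q a) ∂μ ∂μ)
          - (∫ a, ∫ b, min (p a * q b) (p b * q a) ∂μ ∂μ) ^ 2)) / (m * (m - 1))) ≤ t ^ 2)
    (hvu : 8 * ((∫ z, p z ^ 2 / q z ∂μ) - 1) ≤ m * u ^ 2) :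
    P.real {ω | (R : ℝ) / 2 ≤ #{r ∈ (univ : Finset (Fin R)) | (t + u) / (1 - u) ≤
        |((∑ z ∈ (univ : Finset (Fin m)).offDiag,
              min (wt (y ⟨((r : Fin R) : ℕ) * m + z.1, mul_add_lt hRm r z.1⟩ ω))
                (wt (y ⟨((r : Fin R) : ℕ) * m + z.2, mul_add_lt hRm r z.2⟩ ω)))
              / (m * (m - 1) : ℝ))
            / ((∑ j : Fin m, wt (y ⟨((r : Fin R) : ℕ) * m + j, mul_add_lt hRm r j⟩ ω)) / m)
          - ∫ a, ∫ b, min (p a * q b) (p b * q a) ∂μ ∂μ|}}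
      ≤ exp (-(R / 8)) := by
  rcases Nat.eq_zero_or_pos R with hR | hR
  · subst hR
    refine measureReal_le_one.trans ?_
    simp
  have hn : 0 < n := by
    have : 0 < m := by omega
    have : 0 < R * m := Nat.mul_pos hR this
    omega
  haveI hν : IsProbabilityMeasure (μ.withDensity fun z => ENNReal.ofReal (q z)) :=
    isProbabilityMeasure_of_map_eq_iid (hym ⟨0, hn⟩) (hlaw ⟨0, hn⟩)
  obtain ⟨ha0, ha1⟩ := AllPairsVariance.meanAccept_mem_Icc (μ := μ) hp0 hpm hpi hp1 hq0 hqm hqi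
  have hwtm : Measurable wt := by
    have : wt = fun z => c * (p z / q z) := funext hwt
    rw [this]
    exact (hpm.div hqm).const_mul c
  -- the printed block ratio as a measurable function of the block
  have hg : Measurable fun (v : Fin m → X) =>
      ((∑ z ∈ (univ : Finset (Fin m)).offDiag, min (wt (v z.1)) (wt (v z.2))) / (m * (m - 1) : ℝ))
        / ((∑ j : Fin m, wt (v j)) / m) := by
    refine Measurable.div (Measurable.div_const (Finset.measurable_sum _
      fun (z : Fin m × Fin m) _ => ?_) _) (Measurable.div_const (Finset.measurable_sum _
      fun (j : Fin m) _ => hwtm.comp (measurable_pi_apply j)) _)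
    exact (hwtm.comp (measurable_pi_apply z.1)).min (hwtm.comp (measurable_pi_apply z.2))
  have h2 : (2 : ℝ) ≤ m := by exact_mod_cast hm
  have hm0 : (0 : ℝ) < m := by linarith
  have hden : (0 : ℝ) < m * (m - 1) := by
    have : (0 : ℝ) < m - 1 := by linarith
    positivity
  -- each block is bad with probability ≤ 1/8 + 1/8
  have hfar : ∀ r ∈ (univ : Finset (Fin R)), P.real {ω | (t + u) / (1 - u) ≤
      |((∑ z ∈ (univ : Finset (Fin m)).offDiag,
            min (wt (y ⟨(r : ℕ) * m + z.1, mul_add_lt hRm r z.1⟩ ω))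
              (wt (y ⟨(r : ℕ) * m + z.2, mul_add_lt hRm r z.2⟩ ω))) / (m * (m - 1) : ℝ))
          / ((∑ j : Fin m, wt (y ⟨(r : ℕ) * m + j, mul_add_lt hRm r j⟩ ω)) / m)
        - ∫ a, ∫ b, min (p a * q b) (p b * q a) ∂μ ∂μ|} ≤ 1 / 4 := by
    intro r _
    have hU := blockAllPairs_chebyshev hym hind hp0 hpm hpi hp1 hq0 hqm hqi hlaw hm hRm r ht
    have hW := meanWeight_chebyshev_iid
      (x := fun (i : Fin m) => y ⟨(r : ℕ) * m + i, mul_add_lt hRm r i⟩) (fun i => hym _)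
      (iIndepFun_block hind hRm r) hpm hpi hp1 hq0 hqm hM2i (fun i => hlaw _) (by omega) hu
    have hratio : ∀ ω,
        ((∑ z ∈ (univ : Finset (Fin m)).offDiag,
            min (wt (y ⟨(r : ℕ) * m + z.1, mul_add_lt hRm r z.1⟩ ω))
              (wt (y ⟨(r : ℕ) * m + z.2, mul_add_lt hRm r z.2⟩ ω))) / (m * (m - 1) : ℝ))
          / ((∑ j : Fin m, wt (y ⟨(r : ℕ) * m + j, mul_add_lt hRm r j⟩ ω)) / m)
        = ((∑ z ∈ (univ : Finset (Fin m)).offDiag,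
              min (p (y ⟨(r : ℕ) * m + z.1, mul_add_lt hRm r z.1⟩ ω)
                    / q (y ⟨(r : ℕ) * m + z.1, mul_add_lt hRm r z.1⟩ ω))
                  (p (y ⟨(r : ℕ) * m + z.2, mul_add_lt hRm r z.2⟩ ω)
                    / q (y ⟨(r : ℕ) * m + z.2, mul_add_lt hRm r z.2⟩ ω)))
              / (m * (m - 1) : ℝ))
            / ((∑ j : Fin m, p (y ⟨(r : ℕ) * m + j, mul_add_lt hRm r j⟩ ω)
                / q (y ⟨(r : ℕ) * m + j, mul_add_lt hRm r j⟩ ω)) / m) :=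
      fun ω => blockRatio_scale_free hc hwt fun i => y ⟨(r : ℕ) * m + i, mul_add_lt hRm r i⟩ ω
    have hsub : {ω | (t + u) / (1 - u) ≤
          |((∑ z ∈ (univ : Finset (Fin m)).offDiag,
                min (wt (y ⟨(r : ℕ) * m + z.1, mul_add_lt hRm r z.1⟩ ω))
                  (wt (y ⟨(r : ℕ) * m + z.2, mul_add_lt hRm r z.2⟩ ω))) / (m * (m - 1) : ℝ))
              / ((∑ j : Fin m, wt (y ⟨(r : ℕ) * m + j, mul_add_lt hRm r j⟩ ω)) / m)
            - ∫ a, ∫ b, min (p a * q b) (p b * q a) ∂μ ∂μ|}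
        ⊆ {ω | t ≤ |(∑ z ∈ (univ : Finset (Fin m)).offDiag,
              min (p (y ⟨(r : ℕ) * m + z.1, mul_add_lt hRm r z.1⟩ ω)
                    / q (y ⟨(r : ℕ) * m + z.1, mul_add_lt hRm r z.1⟩ ω))
                  (p (y ⟨(r : ℕ) * m + z.2, mul_add_lt hRm r z.2⟩ ω)
                    / q (y ⟨(r : ℕ) * m + z.2, mul_add_lt hRm r z.2⟩ ω)))
              / (m * (m - 1)) - ∫ a, ∫ b, min (p a * q b) (p b * q a) ∂μ ∂μ|}
          ∪ {ω | u ≤ |(∑ j : Fin m, p (y ⟨(r : ℕ) * m + j, mul_add_lt hRm r j⟩ ω)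
              / q (y ⟨(r : ℕ) * m + j, mul_add_lt hRm r j⟩ ω)) / m - 1|} := by
      intro ω hω
      simp only [mem_setOf_eq, mem_union] at hω ⊢
      rw [hratio ω] at hω
      by_contra hcon
      simp only [not_or, not_le] at hcon
      have key := abs_div_sub_lt_of_abs_sub_lt ha0 ha1 hu1 hcon.1 hcon.2
      linarith
    have hU' : (2 * (1 - (∫ a, ∫ b, min (p a * q b) (p b * q a) ∂μ ∂μ) ^ 2)
          + 4 * (m - 2) * ((∫ a, ∫ b, min (p a * q b) (p b * q a) ∂μ ∂μ)
            - (∫ a, ∫ b, min (p a * q b) (p b * q a) ∂μ ∂μ) ^ 2)) / (m * (m - 1)) / t ^ 2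
        ≤ 1 / 8 := by
      rw [div_le_iff₀ (pow_pos ht 2)]
      linarith
    have hW' : ((∫ z, p z ^ 2 / q z ∂μ) - 1) / (m * u ^ 2) ≤ 1 / 8 := by
      rw [div_le_iff₀ (by positivity)]
      linarith
    calc P.real _ ≤ P.real _ := measureReal_mono hsub
      _ ≤ _ := measureReal_union_le _ _
      _ ≤ 1 / 8 + 1 / 8 := add_le_add (hU.trans hU') (hW.trans hW')
      _ = 1 / 4 := by norm_num
  -- the printed block ratios are independent across blocks and measurable
  have hYind : iIndepFun (fun (r : Fin R) ω =>
      ((∑ z ∈ (univ : Finset (Fin m)).offDiag,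
          min (wt (y ⟨(r : ℕ) * m + z.1, mul_add_lt hRm r z.1⟩ ω))
            (wt (y ⟨(r : ℕ) * m + z.2, mul_add_lt hRm r z.2⟩ ω))) / (m * (m - 1) : ℝ))
        / ((∑ j : Fin m, wt (y ⟨(r : ℕ) * m + j, mul_add_lt hRm r j⟩ ω)) / m)) P :=
    iIndepFun_blockFun hym hind hRm hg
  have hYm : ∀ r : Fin R, Measurable fun ω =>
      ((∑ z ∈ (univ : Finset (Fin m)).offDiag,
          min (wt (y ⟨(r : ℕ) * m + z.1, mul_add_lt hRm r z.1⟩ ω))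
            (wt (y ⟨(r : ℕ) * m + z.2, mul_add_lt hRm r z.2⟩ ω))) / (m * (m - 1) : ℝ))
        / ((∑ j : Fin m, wt (y ⟨(r : ℕ) * m + j, mul_add_lt hRm r j⟩ ω)) / m) := fun r => by
    have hblk : Measurable fun ω => fun (i : Fin m) => y ⟨(r : ℕ) * m + i, mul_add_lt hRm r i⟩ ω :=
      measurable_pi_lambda _ fun i => hym _
    exact hg.comp hblk
  have h := measureReal_half_far_le (μ := P) (univ : Finset (Fin R)) hYind hYm
    (∫ a, ∫ b, min (p a * q b) (p b * q a) ∂μ ∂μ) ((t + u) / (1 - u)) hfar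
  simpa only [card_univ, Fintype.card_fin] using h

/-- **THE PRINTED RATIO, CEILING-FREE, A-PRIORI RADII, FOR ANY SAMPLE MEDIAN.**  Same setting;
`med(ω)` is ANY selection of a sample median of the `R` printed block ratios; radii with
`8/(m − 1) ≤ t²`, `8(M₂ − 1) ≤ m u²`, `0 < u < 1`: `P( (t+u)/(1−u) ≤ |med − acc(p,q)| ) ≤ exp(−R/8)`
— the effective sample size (`M₂ = 1/ESS`) is the only analytic input. [ours] -/
theorem printedAcceptance_sampleMedian_confidence {y : Fin n → Ω → X}
    (hym : ∀ j, Measurable (y j)) (hind : iIndepFun y P) {p q : X → ℝ} (hp0 : ∀ z, 0 ≤ p z)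
    (hpm : Measurable p) (hpi : Integrable p μ) (hp1 : ∫ z, p z ∂μ = 1) (hq0 : ∀ z, 0 < q z)
    (hqm : Measurable q) (hqi : Integrable q μ) (hM2i : Integrable (fun z => p z ^ 2 / q z) μ)
    (hlaw : ∀ j, Measure.map (y j) P = μ.withDensity fun z => ENNReal.ofReal (q z))
    {wt : X → ℝ} {c : ℝ} (hc : 0 < c) (hwt : ∀ z, wt z = c * (p z / q z))
    (hm : 2 ≤ m) (hRm : R * m ≤ n) {t u : ℝ} (ht : 0 < t) (hu : 0 < u) (hu1 : u < 1)
    (hmt : 8 / (m - 1 : ℝ) ≤ t ^ 2) (hvu : 8 * ((∫ z, p z ^ 2 / q z ∂μ) - 1) ≤ m * u ^ 2)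
    {med : Ω → ℝ}
    (hlo : ∀ ω, (R : ℝ) / 2 ≤ #{r ∈ (univ : Finset (Fin R)) | med ω ≤
        ((∑ z ∈ (univ : Finset (Fin m)).offDiag,
              min (wt (y ⟨((r : Fin R) : ℕ) * m + z.1, mul_add_lt hRm r z.1⟩ ω))
                (wt (y ⟨((r : Fin R) : ℕ) * m + z.2, mul_add_lt hRm r z.2⟩ ω)))
              / (m * (m - 1) : ℝ))
            / ((∑ j : Fin m, wt (y ⟨((r : Fin R) : ℕ) * m + j, mul_add_lt hRm r j⟩ ω)) / m)})
    (hhi : ∀ ω, (R : ℝ) / 2 ≤ #{r ∈ (univ : Finset (Fin R)) |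
        ((∑ z ∈ (univ : Finset (Fin m)).offDiag,
              min (wt (y ⟨((r : Fin R) : ℕ) * m + z.1, mul_add_lt hRm r z.1⟩ ω))
                (wt (y ⟨((r : Fin R) : ℕ) * m + z.2, mul_add_lt hRm r z.2⟩ ω)))
              / (m * (m - 1) : ℝ))
            / ((∑ j : Fin m, wt (y ⟨((r : Fin R) : ℕ) * m + j, mul_add_lt hRm r j⟩ ω)) / m)
          ≤ med ω}) :
    P.real {ω | (t + u) / (1 - u) ≤ |med ω - ∫ a, ∫ b, min (p a * q b) (p b * q a) ∂μ ∂μ|}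
      ≤ exp (-(R / 8)) := by
  have hvt : 8 * ((2 * (1 - (∫ a, ∫ b, min (p a * q b) (p b * q a) ∂μ ∂μ) ^ 2)
        + 4 * (m - 2) * ((∫ a, ∫ b, min (p a * q b) (p b * q a) ∂μ ∂μ)
          - (∫ a, ∫ b, min (p a * q b) (p b * q a) ∂μ ∂μ) ^ 2)) / (m * (m - 1))) ≤ t ^ 2 := by
    refine ((mul_le_mul_of_nonneg_left (acceptanceEnvelope_le_inv hm) (by norm_num)).trans ?_)
    rw [mul_one_div]
    exact hmt
  refine (measureReal_mono ?_).trans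
    (printedAcceptance_medianOfBlocks_confidence hym hind hp0 hpm hpi hp1 hq0 hqm hqi hM2i hlaw hc
      hwt hm hRm ht hu hu1 hvt hvu)
  intro ω hω
  simp only [Set.mem_setOf_eq] at hω ⊢
  by_contra hlt
  push Not at hlt
  have hR : (#(univ : Finset (Fin R)) : ℝ) = R := by rw [card_univ, Fintype.card_fin]
  have h := abs_median_sub_lt_of_card_lt (univ : Finset (Fin R)) _ (hR ▸ hlo ω) (hR ▸ hhi ω)
    (hR ▸ hlt)
  linarith

/-- **A versus B from two PRINTED block-ratio medians, no ceiling, no parity hypothesis.**  One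
normalised target `p`; two codes with model densities `q, q′ > 0` (`p²/q, p²/q′ ∈ L¹(μ)`), each
printing its block ratios from ITS OWN stream (possibly on different probability spaces) with its
own unknown normalisation `c, c′ > 0`; any sample-median selections `med, med′`; a-priori radii
`8/(m − 1) ≤ t²`, `8(M₂ − 1) ≤ m u²` and `8/(m′ − 1) ≤ t′²`, `8(M₂′ − 1) ≤ m′ u′²`.  Then the two
bad events together have probability `≤ e^{−R/8} + e^{−R′/8}`; outside them
`|(med − med′) − (acc(p,q) − acc(p,q′))| < (t+u)/(1−u) + (t′+u′)/(1−u′)`. [ours] -/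
theorem printedAcceptance_AB_sampleMedian_confidence {n' m' R' : ℕ} {Ω' : Type*}
    [MeasurableSpace Ω'] {P' : Measure Ω'} [IsProbabilityMeasure P'] {y : Fin n → Ω → X}
    {y' : Fin n' → Ω' → X} (hym : ∀ j, Measurable (y j)) (hind : iIndepFun y P)
    (hym' : ∀ j, Measurable (y' j)) (hind' : iIndepFun y' P') {p q q' : X → ℝ}
    (hp0 : ∀ z, 0 ≤ p z) (hpm : Measurable p) (hpi : Integrable p μ) (hp1 : ∫ z, p z ∂μ = 1)
    (hq0 : ∀ z, 0 < q z) (hqm : Measurable q) (hqi : Integrable q μ)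
    (hM2i : Integrable (fun z => p z ^ 2 / q z) μ)
    (hq0' : ∀ z, 0 < q' z) (hqm' : Measurable q') (hqi' : Integrable q' μ)
    (hM2i' : Integrable (fun z => p z ^ 2 / q' z) μ)
    (hlaw : ∀ j, Measure.map (y j) P = μ.withDensity fun z => ENNReal.ofReal (q z))
    (hlaw' : ∀ j, Measure.map (y' j) P' = μ.withDensity fun z => ENNReal.ofReal (q' z))
    {wt wt' : X → ℝ} {c c' : ℝ} (hc : 0 < c) (hwt : ∀ z, wt z = c * (p z / q z)) (hc' : 0 < c')
    (hwt' : ∀ z, wt' z = c' * (p z / q' z)) (hm : 2 ≤ m) (hRm : R * m ≤ n) (hm' : 2 ≤ m')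
    (hRm' : R' * m' ≤ n') {t u t' u' : ℝ} (ht : 0 < t) (hu : 0 < u) (hu1 : u < 1)
    (hmt : 8 / (m - 1 : ℝ) ≤ t ^ 2) (hvu : 8 * ((∫ z, p z ^ 2 / q z ∂μ) - 1) ≤ m * u ^ 2)
    (ht' : 0 < t') (hu' : 0 < u') (hu1' : u' < 1) (hmt' : 8 / (m' - 1 : ℝ) ≤ t' ^ 2)
    (hvu' : 8 * ((∫ z, p z ^ 2 / q' z ∂μ) - 1) ≤ m' * u' ^ 2) {med : Ω → ℝ} {med' : Ω' → ℝ}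
    (hlo : ∀ ω, (R : ℝ) / 2 ≤ #{r ∈ (univ : Finset (Fin R)) | med ω ≤
        ((∑ z ∈ (univ : Finset (Fin m)).offDiag,
              min (wt (y ⟨((r : Fin R) : ℕ) * m + z.1, mul_add_lt hRm r z.1⟩ ω))
                (wt (y ⟨((r : Fin R) : ℕ) * m + z.2, mul_add_lt hRm r z.2⟩ ω)))
              / (m * (m - 1) : ℝ))
            / ((∑ j : Fin m, wt (y ⟨((r : Fin R) : ℕ) * m + j, mul_add_lt hRm r j⟩ ω)) / m)})
    (hhi : ∀ ω, (R : ℝ) / 2 ≤ #{r ∈ (univ : Finset (Fin R)) |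
        ((∑ z ∈ (univ : Finset (Fin m)).offDiag,
              min (wt (y ⟨((r : Fin R) : ℕ) * m + z.1, mul_add_lt hRm r z.1⟩ ω))
                (wt (y ⟨((r : Fin R) : ℕ) * m + z.2, mul_add_lt hRm r z.2⟩ ω)))
              / (m * (m - 1) : ℝ))
            / ((∑ j : Fin m, wt (y ⟨((r : Fin R) : ℕ) * m + j, mul_add_lt hRm r j⟩ ω)) / m)
          ≤ med ω})
    (hlo' : ∀ ω, (R' : ℝ) / 2 ≤ #{r ∈ (univ : Finset (Fin R')) | med' ω ≤
        ((∑ z ∈ (univ : Finset (Fin m')).offDiag,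
              min (wt' (y' ⟨((r : Fin R') : ℕ) * m' + z.1, mul_add_lt hRm' r z.1⟩ ω))
                (wt' (y' ⟨((r : Fin R') : ℕ) * m' + z.2, mul_add_lt hRm' r z.2⟩ ω)))
              / (m' * (m' - 1) : ℝ))
            / ((∑ j : Fin m', wt' (y' ⟨((r : Fin R') : ℕ) * m' + j, mul_add_lt hRm' r j⟩ ω))
              / m')})
    (hhi' : ∀ ω, (R' : ℝ) / 2 ≤ #{r ∈ (univ : Finset (Fin R')) |
        ((∑ z ∈ (univ : Finset (Fin m')).offDiag,
              min (wt' (y' ⟨((r : Fin R') : ℕ) * m' + z.1, mul_add_lt hRm' r z.1⟩ ω))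
                (wt' (y' ⟨((r : Fin R') : ℕ) * m' + z.2, mul_add_lt hRm' r z.2⟩ ω)))
              / (m' * (m' - 1) : ℝ))
            / ((∑ j : Fin m', wt' (y' ⟨((r : Fin R') : ℕ) * m' + j, mul_add_lt hRm' r j⟩ ω))
              / m') ≤ med' ω}) :
    P.real {ω | (t + u) / (1 - u) ≤ |med ω - ∫ a, ∫ b, min (p a * q b) (p b * q a) ∂μ ∂μ|}
      + P'.real {ω | (t' + u') / (1 - u')
          ≤ |med' ω - ∫ a, ∫ b, min (p a * q' b) (p b * q' a) ∂μ ∂μ|}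
      ≤ exp (-(R / 8)) + exp (-(R' / 8)) :=
  add_le_add
    (printedAcceptance_sampleMedian_confidence hym hind hp0 hpm hpi hp1 hq0 hqm hqi hM2i hlaw hc
      hwt hm hRm ht hu hu1 hmt hvu hlo hhi)
    (printedAcceptance_sampleMedian_confidence hym' hind' hp0 hpm hpi hp1 hq0' hqm' hqi' hM2i'
      hlaw' hc' hwt' hm' hRm' ht' hu' hu1' hmt' hvu' hlo' hhi')

end Certificate

end Summit.Ventures.LatticeQCDFlow.Scoring.AllPairsMedian

end
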